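import Summits.AtomisticToContinuum.Crystallization.Theses.ChessboardParticlePlanes
import Summits.AtomisticToContinuum.Crystallization.Theses.LaminarSixThreeThree
import Mathlib.Analysis.InnerProductSpace.PiL2
import Mathlib.Analysis.Normed.Operator.LinearIsometry
import Literature.MathematicalPhysics.StatisticalMechanics.MuGroundStateConfiguration
import Literature.MathematicalPhysics.StatisticalMechanics.BarlowStacking
import Literature.MathematicalPhysics.StatisticalMechanics.HaggStacking
import Summits.AtomisticToContinuum.Crystallization.Theorems.ChessboardParticlePlanesPeriodicWindowsInputGlue
import Summits.AtomisticToContinuum.Crystallization.Theorems.ChessboardParticlePlanesPeriodicWindowsStubLaminarLimit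
import Summits.AtomisticToContinuum.Crystallization.Theorems.ChessboardParticlePlanesLjLaminarWindowsMinDistance
import Summits.AtomisticToContinuum.Crystallization.Theorems.PhononSlackCertificatesPeriodicGivenLayered
import Summits.AtomisticToContinuum.Crystallization.Theorems.ChessboardParticlePlanesPeriodicWindowsStubRecurrentHullPoint
import Summits.AtomisticToContinuum.Crystallization.Theorems.ChessboardParticlePlanesPeriodicWindowsStubWindowsOfTemplateHullPoint

/-!
# Crux `PeriodicWindows` (stmt-AtomisticToContinuum-3240) — glue of the three-way split along line `dense-laminar-hull`

Crux-strategist s2 (2026-08-17). The live line `Cruxes/PeriodicWindows/Lines/dense_laminar_hull.lean` (lead c10, rev 6)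
proves the crux from five registered stubs; this file is the SORRY-FREE implication from three route-level children to
the crux BY NAME, for `ledger route edit route-AtomisticToContinuum-ChessboardParticlePlanes --split PeriodicWindows
--into children3.json` (glue item closed by landing this file):

* child 1 `DenseLaminarHullPoint` — layering + cohesion in hull form (wall W1): some `ρ₀ > 0` such that every Lennard-Jones
  ground-state sequence has a `ρ₀`-dense, exactly laminar (levels `≥ 3/4` apart), `7/10`-separated point in its rotated hull
  (the hypothesis of the line's old stub 3; implied by items stmt-14293 `LjLaminarity` ∧ stmt-13453 `NoFoam` through the landed
  `PeriodicWindowsSketch.laminarWindowsGeom_of` + `PeriodicWindowsSketch.stub_laminarLimit`, see `denseLaminarHullPoint_of`);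
* child 2 `TriangularLayers` — the promoted stub P3a-i `stub_triangularLayers`: every layer of a rooted, rooted-uniformly
  recurrent, dense, exactly laminar, `7/10`-separated rotated-hull point of a ground-state sequence is a translate of some
  horizontal triangular lattice (wall W2: sandwiched planar Lennard-Jones order at `ε = 0`);
* child 3 `TemplateOfTriangularLayers` — triangular layers ⇒ rigid image of the layered template of item 11778 (one spacing
  `a ∈ [47/50, 1]`, Hägg registry, gaps in `[39a/50, 17a/20]`); bundles P3a-ii `stub_alignedLayers`, P3b2
  `stub_closingOverTorus` and the landed P3b1 `stub_layerData` (11779-type density closing, XL).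

Glue = landed P1 `PeriodicWindowsDenseLaminarHull.stub_recurrentHullPoint` (p141859; rooted, uniformly recurrent) ⇒ children
2, 3 ⇒ landed P2 `PeriodicWindowsDenseLaminarHull.stub_windowsOfTemplateHullPoint` (p142408; layered windows along `x`) ⇒
landed `LayeredHull.PeriodicGivenLayered_of` (item 11779) ⇒ `PeriodicWindows`. No child alone gives the crux: 1 says nothing
about in-layer order, 2 nothing about registry or spacing, 3 is conditional on 2. Also recorded: `denseLaminarHullPoint_of`,
child 1 from the two density-zero board items (14293, 13453) by the landed G0/S1 and the `7/10` minimal distance.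
-/

noncomputable section

namespace Summit.AtomisticToContinuum.Crystallization.Theorems.PeriodicWindowsSplit3

open Literature.MathematicalPhysics.StatisticalMechanics Filter Metric
open Summit.AtomisticToContinuum.Crystallization.Theses.ChessboardParticlePlanes (PeriodicWindows)
open Summit.AtomisticToContinuum.Crystallization.Theorems.PeriodicWindowsSketch (laminarWindowsGeom_of stub_laminarLimit)
open Summit.AtomisticToContinuum.Crystallization.Theorems.LjLaminarWindowsSketch (lennardJones_groundState_dist_ge_seven_tenths)
open Summit.AtomisticToContinuum.Crystallization.Theorems.PeriodicWindowsDenseLaminarHull (stub_recurrentHullPoint stub_windowsOfTemplateHullPoint)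

/-- The `7/10`-separation input of the landed glue `laminarWindowsGeom_of` holds outright: by the landed minimal
distance of Lennard-Jones ground states no two particles of a ground state are closer than `7/10`, so the counted set is
empty and the fraction is identically `0` (as in the line file). [folklore] -/
theorem sepDensity_holds : ∀ R : ℝ, 0 < R → ∀ x : (N : ℕ) → (Fin N → EuclideanSpace ℝ (Fin 3)),
    (∀ N, IsGroundState lennardJones (x N)) →
    Filter.Tendsto (fun N : ℕ => (Nat.card {i : Fin N // ∃ j k : Fin N, j ≠ k ∧
      dist (x N j) (x N i) ≤ R ∧ dist (x N k) (x N i) ≤ R ∧ dist (x N j) (x N k) < 7 / 10} : ℝ) / N)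
      Filter.atTop (nhds 0) := by
  intro R _ x hx
  have h0 : ∀ N : ℕ, (Nat.card {i : Fin N // ∃ j k : Fin N, j ≠ k ∧
      dist (x N j) (x N i) ≤ R ∧ dist (x N k) (x N i) ≤ R ∧ dist (x N j) (x N k) < 7 / 10} : ℝ) / N = 0 := by
    intro N
    have : IsEmpty {i : Fin N // ∃ j k : Fin N, j ≠ k ∧
        dist (x N j) (x N i) ≤ R ∧ dist (x N k) (x N i) ≤ R ∧ dist (x N j) (x N k) < 7 / 10} := by
      refine ⟨fun ⟨i, j, k, hjk, _, _, hlt⟩ => ?_⟩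
      exact absurd (lennardJones_groundState_dist_ge_seven_tenths (hx N) hjk) (not_le.mpr hlt)
    rw [Nat.card_of_isEmpty]
    simp
  simp_rw [h0]
  exact tendsto_const_nhds

/-- **Child 1 from the board items**: a.e. laminarity (item stmt-14293 `LjLaminarity`, verbatim) and no-foam (item
stmt-13453 `NoFoam`, verbatim) give `DenseLaminarHullPoint` — landed G0 `laminarWindowsGeom_of` over the two inputs and
`sepDensity_holds`, then landed S1 `stub_laminarLimit`. [folklore] -/
theorem denseLaminarHullPoint_of
    (hlam : ∀ t R : ℝ, 0 < t → 0 < R → ∀ x : (N : ℕ) → (Fin N → EuclideanSpace ℝ (Fin 3)), (∀ N, Literature.MathematicalPhysics.StatisticalMechanics.IsGroundState Literature.MathematicalPhysics.StatisticalMechanics.lennardJones (x N)) → Filter.Tendsto (fun N : ℕ => (Nat.card {i : Fin N // ¬ (∃ n : EuclideanSpace ℝ (Fin 3), ‖n‖ = 1 ∧ ∃ c : ℤ → ℝ, (∀ k : ℤ, c k + 3 / 4 ≤ c (k + 1)) ∧ ∀ j : Fin N, dist (x N j) (x N i) ≤ R → ∃ k : ℤ, |inner ℝ (x N j - x N i)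 n - c k| ≤ t)} : ℝ) / N) Filter.atTop (nhds 0))
    (hfoam : ∃ r₀ : ℝ, 0 < r₀ ∧ ∀ R : ℝ, 0 < R → ∀ x : (N : ℕ) → (Fin N → EuclideanSpace ℝ (Fin 3)), (∀ N, Literature.MathematicalPhysics.StatisticalMechanics.IsGroundState Literature.MathematicalPhysics.StatisticalMechanics.lennardJones (x N)) → Filter.Tendsto (fun N : ℕ => (Nat.card {i : Fin N // ∃ c : EuclideanSpace ℝ (Fin 3), dist c (x N i) ≤ R ∧ ∀ j : Fin N, r₀ ≤ dist c (x N j)} : ℝ) / N) Filter.atTop (nhds 0)) :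
    ∃ ρ₀ : ℝ, 0 < ρ₀ ∧ ∀ x : (N : ℕ) → (Fin N → EuclideanSpace ℝ (Fin 3)), (∀ N, Literature.MathematicalPhysics.StatisticalMechanics.IsGroundState Literature.MathematicalPhysics.StatisticalMechanics.lennardJones (x N)) → ∃ X : Set (EuclideanSpace ℝ (Fin 3)), (∃ (σ : ℕ → ℕ) (τ : ℕ → EuclideanSpace ℝ (Fin 3)) (A : ℕ → (EuclideanSpace ℝ (Fin 3) ≃ₗᵢ[ℝ] EuclideanSpace ℝ (Fin 3))), StrictMono σ ∧ ∀ R ε : ℝ, 0 < ε → ∀ᶠ j in Filter.atTop, Literature.MathematicalPhysics.StatisticalMechanics.BallMatch ε R 0 (Set.range fun i => A j (x (σ j) i) + τ j) X) ∧ (∀ c : EuclideanSpace ℝ (Fin 3), ∃ p ∈ X, dist p c ≤ ρ₀) ∧ (∀ p ∈ X, ∀ q ∈ X, p 2 ≠ q 2 → (3 : ℝ) / 4 ≤ |p 2 - q 2|) ∧ (∀ p ∈ X, ∀ q ∈ X, p ≠ q → (7 : ℝ) / 10 ≤ dist p q) := by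
  obtain ⟨ρ₀, hρ₀, hgeom⟩ := laminarWindowsGeom_of hlam sepDensity_holds hfoam
  exact ⟨ρ₀, hρ₀, fun x hx => stub_laminarLimit ρ₀ hρ₀ x hx (hgeom x hx)⟩

/-- **Glue of the three-way split** `DenseLaminarHullPoint → TriangularLayers → TemplateOfTriangularLayers →
PeriodicWindows` (children statements verbatim, fully qualified as filed in `children3.json`): the dense laminar separated
rotated-hull point is re-rooted to a uniformly recurrent one (P1); in-layer triangular order (child 2) and the template
closing (child 3) make it a rigid image of the layered template; P2 turns that into the layered windows of item 11778
along the sequence and the landed stacking selection `PeriodicGivenLayered_of` (item 11779) into periodic windows.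
[folklore] -/
theorem PeriodicWindows_of_subs
    (h₁ : ∃ ρ₀ : ℝ, 0 < ρ₀ ∧ ∀ x : (N : ℕ) → (Fin N → EuclideanSpace ℝ (Fin 3)), (∀ N, Literature.MathematicalPhysics.StatisticalMechanics.IsGroundState Literature.MathematicalPhysics.StatisticalMechanics.lennardJones (x N)) → ∃ X : Set (EuclideanSpace ℝ (Fin 3)), (∃ (σ : ℕ → ℕ) (τ : ℕ → EuclideanSpace ℝ (Fin 3)) (A : ℕ → (EuclideanSpace ℝ (Fin 3) ≃ₗᵢ[ℝ] EuclideanSpace ℝ (Fin 3))), StrictMono σ ∧ ∀ R ε : ℝ, 0 < ε → ∀ᶠ j in Filter.atTop, Literature.MathematicalPhysics.StatisticalMechanics.BallMatch ε R 0 (Set.range fun i => A j (x (σ j) i) + τ j) X) ∧ (∀ c : EuclideanSpace ℝ (Fin 3), ∃ p ∈ X, dist p c ≤ ρ₀) ∧ (∀ p ∈ X, ∀ q ∈ X, p 2 ≠ q 2 → (3 : ℝ) / 4 ≤ |p 2 - q 2|) ∧ (∀ p ∈ X, ∀ q ∈ X, p ≠ q → (7 : ℝ) / 10 ≤ dist p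 q))
    (h₂ : ∀ ρ₀ : ℝ, 0 < ρ₀ → ∀ x : (N : ℕ) → (Fin N → EuclideanSpace ℝ (Fin 3)), (∀ N, Literature.MathematicalPhysics.StatisticalMechanics.IsGroundState Literature.MathematicalPhysics.StatisticalMechanics.lennardJones (x N)) → ∀ Z : Set (EuclideanSpace ℝ (Fin 3)), (0 : EuclideanSpace ℝ (Fin 3)) ∈ Z → (∃ (σ : ℕ → ℕ) (τ : ℕ → EuclideanSpace ℝ (Fin 3)) (A : ℕ → (EuclideanSpace ℝ (Fin 3) ≃ₗᵢ[ℝ] EuclideanSpace ℝ (Fin 3))), StrictMono σ ∧ ∀ R ε : ℝ, 0 < ε → ∀ᶠ j in Filter.atTop, Literature.MathematicalPhysics.StatisticalMechanics.BallMatch ε R 0 (Set.range fun i => A j (x (σ j) i) + τ j) Z) → (∀ c : EuclideanSpace ℝ (Fin 3), ∃ p ∈ Z, dist p c ≤ ρ₀) → (∀ p ∈ Z, ∀ q ∈ Z, p 2 ≠ q 2 → (3 : ℝ) / 4 ≤ |p 2 - q 2|) → (∀ p ∈ Z, ∀ q ∈ Z, p ≠ q → (7 : ℝ) / 10 ≤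 dist p q) → (∀ R ε : ℝ, 0 < ε → ∃ G : ℝ, ∀ w ∈ Z, ∃ g ∈ Z, dist g w ≤ G ∧ Literature.MathematicalPhysics.StatisticalMechanics.BallMatch ε R 0 ((fun p => p - g) '' Z) Z) → ∀ p ∈ Z, ∃ a : ℝ, 0 < a ∧ ∃ u v : EuclideanSpace ℝ (Fin 3), u 2 = 0 ∧ v 2 = 0 ∧ ‖u‖ = a ∧ ‖v‖ = a ∧ inner ℝ u v = a ^ 2 / 2 ∧ {q | q ∈ Z ∧ q 2 = p 2} = {q | ∃ i j : ℤ, q = p + (i : ℝ) • u + (j : ℝ) • v})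
    (h₃ : ∀ ρ₀ : ℝ, 0 < ρ₀ → ∀ x : (N : ℕ) → (Fin N → EuclideanSpace ℝ (Fin 3)), (∀ N, Literature.MathematicalPhysics.StatisticalMechanics.IsGroundState Literature.MathematicalPhysics.StatisticalMechanics.lennardJones (x N)) → ∀ Z : Set (EuclideanSpace ℝ (Fin 3)), (0 : EuclideanSpace ℝ (Fin 3)) ∈ Z → (∃ (σ : ℕ → ℕ) (τ : ℕ → EuclideanSpace ℝ (Fin 3)) (A : ℕ → (EuclideanSpace ℝ (Fin 3) ≃ₗᵢ[ℝ] EuclideanSpace ℝ (Fin 3))), StrictMono σ ∧ ∀ R ε : ℝ, 0 < ε → ∀ᶠ j in Filter.atTop, Literature.MathematicalPhysics.StatisticalMechanics.BallMatch ε R 0 (Set.range fun i => A j (x (σ j) i) + τ j) Z) → (∀ c : EuclideanSpace ℝ (Fin 3), ∃ p ∈ Z, dist p c ≤ ρ₀) → (∀ p ∈ Z, ∀ q ∈ Z, p 2 ≠ q 2 → (3 : ℝ) / 4 ≤ |p 2 - q 2|) → (∀ p ∈ Z, ∀ q ∈ Z, p ≠ q → (7 : ℝ) / 10 ≤ dist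 p q) → (∀ R ε : ℝ, 0 < ε → ∃ G : ℝ, ∀ w ∈ Z, ∃ g ∈ Z, dist g w ≤ G ∧ Literature.MathematicalPhysics.StatisticalMechanics.BallMatch ε R 0 ((fun p => p - g) '' Z) Z) → (∀ p ∈ Z, ∃ a : ℝ, 0 < a ∧ ∃ u v : EuclideanSpace ℝ (Fin 3), u 2 = 0 ∧ v 2 = 0 ∧ ‖u‖ = a ∧ ‖v‖ = a ∧ inner ℝ u v = a ^ 2 / 2 ∧ {q | q ∈ Z ∧ q 2 = p 2} = {q | ∃ i j : ℤ, q = p + (i : ℝ) • u + (j : ℝ) • v}) → ∃ a : ℝ, 47 / 50 ≤ a ∧ a ≤ 1 ∧ ∃ (B : EuclideanSpace ℝ (Fin 3) ≃ₗᵢ[ℝ] EuclideanSpace ℝ (Fin 3)) (t₀ : EuclideanSpace ℝ (Fin 3)) (s : ℤ → ℤ) (z : ℤ → ℝ), Literature.MathematicalPhysics.StatisticalMechanics.IsHaggSeq s ∧ (∀ m : ℤ, 39 / 50 * a ≤ z (m + 1) - z m ∧ z (m + 1) - z m ≤ 17 / 20 * a) ∧ Z = (fun p => B p + t₀) '' {p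 | ∃ m i j : ℤ, p = ((i : ℝ) • Literature.MathematicalPhysics.StatisticalMechanics.triangularVec₁ a) + ((j : ℝ) • Literature.MathematicalPhysics.StatisticalMechanics.triangularVec₂ a) + ((Literature.MathematicalPhysics.StatisticalMechanics.haggLabel s m : ℝ) • Literature.MathematicalPhysics.StatisticalMechanics.barlowOffset a) + (z m • Literature.MathematicalPhysics.StatisticalMechanics.layerNormal 1)}) :
    PeriodicWindows := by
  intro x hx
  obtain ⟨ρ₀, hρ₀, hX⟩ := h₁
  obtain ⟨Z, h0, hhull, hdense, hlam, hsep, hrec⟩ := stub_recurrentHullPoint ρ₀ hρ₀ x (hX x hx)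
  obtain ⟨a, ha, ha', htempl⟩ := h₃ ρ₀ hρ₀ x hx Z h0 hhull hdense hlam hsep hrec
    (h₂ ρ₀ hρ₀ x hx Z h0 hhull hdense hlam hsep hrec)
  have hpgl := Summit.AtomisticToContinuum.Crystallization.Theorems.LayeredHull.PeriodicGivenLayered_of
  unfold Summit.AtomisticToContinuum.Crystallization.Theses.PhononSlackCertificates.PeriodicGivenLayered at hpgl
  exact hpgl x hx ⟨a, ha, ha', stub_windowsOfTemplateHullPoint x a Z hhull htempl⟩


/-- **The glue item BY NAME** (stmt-AtomisticToContinuum-18048, route rev 4): `PeriodicWindowsOfDenseLaminarSubs :=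
DenseLaminarHullPoint → TriangularLayers → TemplateOfTriangularLayers → PeriodicWindows`, closed by `PeriodicWindows_of_subs`
(the three child decls unfold to the binder types verbatim). [folklore] -/
theorem periodicWindowsOfDenseLaminarSubs_proof :
    Summit.AtomisticToContinuum.Crystallization.Theses.ChessboardParticlePlanes.PeriodicWindowsOfDenseLaminarSubs :=
  fun h₁ h₂ h₃ => PeriodicWindows_of_subs h₁ h₂ h₃

/-- **Child 1 BY NAME from the board items** (stmt-18044 ⇐ stmt-14293 ∧ stmt-13453). [folklore] -/
theorem denseLaminarHullPoint_of_board
    (hlam : Summit.AtomisticToContinuum.Crystallization.Theses.LaminarSixThreeThree.LjLaminarity)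
    (hfoam : ∃ r₀ : ℝ, 0 < r₀ ∧ ∀ R : ℝ, 0 < R → ∀ x : (N : ℕ) → (Fin N → EuclideanSpace ℝ (Fin 3)), (∀ N, Literature.MathematicalPhysics.StatisticalMechanics.IsGroundState Literature.MathematicalPhysics.StatisticalMechanics.lennardJones (x N)) → Filter.Tendsto (fun N : ℕ => (Nat.card {i : Fin N // ∃ c : EuclideanSpace ℝ (Fin 3), dist c (x N i) ≤ R ∧ ∀ j : Fin N, r₀ ≤ dist c (x N j)} : ℝ) / N) Filter.atTop (nhds 0)) :
    Summit.AtomisticToContinuum.Crystallization.Theses.ChessboardParticlePlanes.DenseLaminarHullPoint :=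
  denseLaminarHullPoint_of hlam hfoam

end Summit.AtomisticToContinuum.Crystallization.Theorems.PeriodicWindowsSplit3

end
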